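import Summits.AtomisticToContinuum.Crystallization.Theorems.ExcessDecayLiouvilleCaccioppoliTailWeightedBound
import Summits.AtomisticToContinuum.Crystallization.Theorems.ExcessDecayLiouvilleDifferenceQuotient
import Summits.AtomisticToContinuum.Crystallization.Theorems.ExcessDecayLiouvilleLatticeSumConst

/-!
# Route `ExcessDecayLiouville`: local and total masses of translates and differences (linear levels, I)

Linear half of the harmonic-replacement architecture for item `ExcessDecay` (stmt-AtomisticToContinuum-9334): a field
`f` (bounded, finitely supported) which is `L`-harmonic on the sites of a ball, `(L f)(p) = 0` for `dist p c₀ ≤ ρ_f`,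
has its lattice differences `D_τ f = f(· + Aτ) − f` controlled in `ℓ²` on a smaller ball by its own local `ℓ²` mass
and a far term:

* `tsum_indicator_eq_sum` : the local mass `Σ'_p ‖g p‖² 𝟙[dist p c ≤ X]` is the finite sum over the sites of the ball;
* `localMass_translate_le`, `localMass_translate_sub_le`, `totMass_translate_sub_le` : masses of translates and
  differences (`M(D_τ f; X) ≤ 4 M(f; X+2)`, `Mtot(D_τ f) ≤ 4 Mtot(f)`);
* `tail_le_far_mul_totMass` : `TT(f; c, R, ρ) ≤ F₈(ρ) · Mtot(f)`;
* `harm_translate_sub` : differences of a field whose operator rows are a sublattice-constant field are `L`-harmonic;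
* `exists_norm_le_of_finite` : finitely supported fields are bounded.

All `[folklore]`; helper lemmas, nothing here closes an item.
-/

noncomputable section

namespace Summit.AtomisticToContinuum.Crystallization.Theorems.ExcessDecayLiouville

open scoped BigOperators Topology InnerProductSpace RealInnerProductSpace Classical
open Literature.MathematicalPhysics.StatisticalMechanics
open Summit.AtomisticToContinuum.Crystallization.Theorems.PhononStabilityNegative

-- Local notation: the force-constant map `K(e)w = h(|e|²)w + 2⟪e,w⟫h′(|e|²)e`.
local notation3 "𝕂[" e "] " w:max =>
  (-((‖e‖ ^ 2)⁻¹) ^ 7 + ((‖e‖ ^ 2)⁻¹) ^ 4) • w + (2 * ⟪e, w⟫ * (7 * ((‖e‖ ^ 2)⁻¹) ^ 8 - 4 * ((‖e‖ ^ 2)⁻¹) ^ 5)) • e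
set_option quotPrecheck false in
local notation "𝟙ᵇ[" x ", " c ", " R "]" => (if dist (x : EuclideanSpace ℝ (Fin 3)) c ≤ R then (1 : ℝ) else 0)
set_option quotPrecheck false in
local notation "𝔣[" ρ ", " p ", " q "]" =>
  (if ρ < dist (p : EuclideanSpace ℝ (Fin 3)) q then (dist (p : EuclideanSpace ℝ (Fin 3)) q)⁻¹ ^ 8 else (0 : ℝ))

section

variable {t : Fin 2 → (EuclideanSpace ℝ (Fin 3))} {A : (EuclideanSpace ℝ (Fin 3)) →L[ℝ] (EuclideanSpace ℝ (Fin 3))}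

set_option quotPrecheck false in
-- Local notation: the operator row `(L v)(p)`.
local notation "𝕃" v:max " @ " p:max =>
  tsum (fun q : Sites₀ t A => (if ((p : Sites₀ t A) : EuclideanSpace ℝ (Fin 3)) ≠ q then
    𝕂[((p : Sites₀ t A) : EuclideanSpace ℝ (Fin 3)) - q] (v ((p : Sites₀ t A) : EuclideanSpace ℝ (Fin 3)) - v q) else 0))

/-! ## Local masses as finite sums; translates and differences -/

/-- The local mass family is the finite sum over the sites of the ball. [folklore] -/
theorem tsum_indicator_eq_sum (hA : Adm₀ A) (hI : Inner₀ t A) (g : (EuclideanSpace ℝ (Fin 3)) → ℝ)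
    (c : EuclideanSpace ℝ (Fin 3)) (X : ℝ) :
    ∑' p : Sites₀ t A, g p * 𝟙ᵇ[p, c, X] = ∑ x ∈ (finite_sites_dist_le hA hI c X).toFinset, g x := by
  classical
  set F := (finite_sites_dist_le hA hI c X).toFinset with hF
  have hmem : ∀ x, x ∈ F ↔ x ∈ Sites₀ t A ∧ dist x c ≤ X := fun x => by rw [hF, Set.Finite.mem_toFinset]; rfl
  set G : Finset (Sites₀ t A) := F.subtype (· ∈ Sites₀ t A) with hG
  have hmemG : ∀ p : Sites₀ t A, p ∈ G ↔ dist (p : EuclideanSpace ℝ (Fin 3)) c ≤ X := fun p => by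
    rw [hG, Finset.mem_subtype, hmem]; exact ⟨fun h => h.2, fun h => ⟨p.2, h⟩⟩
  rw [tsum_eq_sum (s := G) (fun p hp => by rw [if_neg ((hmemG p).not.1 hp), mul_zero])]
  have h1 : ∑ p ∈ G, g p * 𝟙ᵇ[p, c, X] = ∑ p ∈ G, g (p : EuclideanSpace ℝ (Fin 3)) :=
    Finset.sum_congr rfl fun p hp => by rw [if_pos ((hmemG p).1 hp), mul_one]
  rw [h1, hG, Finset.sum_subtype_of_mem (f := g) (fun x hx => ((hmem x).1 hx).1)]

/-- Mass of a lattice translate on a ball is at most the mass on the ball enlarged by the step. [folklore] -/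
theorem localMass_translate_le (f : (EuclideanSpace ℝ (Fin 3)) → (EuclideanSpace ℝ (Fin 3)))
    (c : EuclideanSpace ℝ (Fin 3)) (X : ℝ) {τ : EuclideanSpace ℝ (Fin 3)} (hτ : τ ∈ Λ₀) {d : ℝ} (hd : ‖A τ‖ ≤ d)
    (hsum : Summable fun p : Sites₀ t A => ‖f p‖ ^ 2 * 𝟙ᵇ[p, c, X + d]) :
    ∑' p : Sites₀ t A, ‖f ((p : EuclideanSpace ℝ (Fin 3)) + A τ)‖ ^ 2 * 𝟙ᵇ[p, c, X] ≤
      ∑' p : Sites₀ t A, ‖f p‖ ^ 2 * 𝟙ᵇ[p, c, X + d] := by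
  -- reindex by the site shift
  have hre := tsum_sites_translate (t := t) (A := A)
    (fun x : EuclideanSpace ℝ (Fin 3) => ‖f x‖ ^ 2 * (if dist (x - A τ) c ≤ X then (1 : ℝ) else 0)) hτ
  simp only [add_sub_cancel_right] at hre
  rw [hre]
  refine Summable.tsum_le_tsum (fun p => ?_) ?_ hsum
  · have h0 : 0 ≤ ‖f p‖ ^ 2 := sq_nonneg _
    by_cases hx : dist ((p : EuclideanSpace ℝ (Fin 3)) - A τ) c ≤ X
    · have : dist (p : EuclideanSpace ℝ (Fin 3)) c ≤ X + d := by
        have h1 := dist_triangle (p : EuclideanSpace ℝ (Fin 3)) ((p : EuclideanSpace ℝ (Fin 3)) - A τ) c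
        have h2 : dist (p : EuclideanSpace ℝ (Fin 3)) ((p : EuclideanSpace ℝ (Fin 3)) - A τ) = ‖A τ‖ := by
          rw [dist_eq_norm, sub_sub_cancel]
        linarith
      rw [if_pos hx, if_pos this]
    · rw [if_neg hx, mul_zero]
      split_ifs <;> positivity
  · -- the reindexed family is summable (dominated)
    refine Summable.of_nonneg_of_le (fun p => by split_ifs <;> positivity) (fun p => ?_) hsum
    by_cases hx : dist ((p : EuclideanSpace ℝ (Fin 3)) - A τ) c ≤ X
    · have : dist (p : EuclideanSpace ℝ (Fin 3)) c ≤ X + d := by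
        have h1 := dist_triangle (p : EuclideanSpace ℝ (Fin 3)) ((p : EuclideanSpace ℝ (Fin 3)) - A τ) c
        have h2 : dist (p : EuclideanSpace ℝ (Fin 3)) ((p : EuclideanSpace ℝ (Fin 3)) - A τ) = ‖A τ‖ := by
          rw [dist_eq_norm, sub_sub_cancel]
        linarith
      rw [if_pos hx, if_pos this]
    · rw [if_neg hx, mul_zero]
      split_ifs <;> positivity

/-- **Local mass of a difference**: `M(D_τ f; X) ≤ 4 M(f; X + d)` when `‖Aτ‖ ≤ d`, `d ≥ 0`. [folklore] -/
theorem localMass_translate_sub_le (hA : Adm₀ A) (hI : Inner₀ t A) (f : (EuclideanSpace ℝ (Fin 3)) → (EuclideanSpace ℝ (Fin 3)))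
    (c : EuclideanSpace ℝ (Fin 3)) (X : ℝ) {τ : EuclideanSpace ℝ (Fin 3)} (hτ : τ ∈ Λ₀) {d : ℝ} (hd : ‖A τ‖ ≤ d) (hd0 : 0 ≤ d) :
    ∑' p : Sites₀ t A, ‖f ((p : EuclideanSpace ℝ (Fin 3)) + A τ) - f p‖ ^ 2 * 𝟙ᵇ[p, c, X] ≤
      4 * ∑' p : Sites₀ t A, ‖f p‖ ^ 2 * 𝟙ᵇ[p, c, X + d] := by
  have hs1 := summable_normSq_indicator hA hI f c (X + d)
  have hs0 := summable_normSq_indicator hA hI f c X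
  have hsT := summable_normSq_indicator hA hI (fun x => f (x + A τ)) c X
  have hsD := summable_normSq_indicator hA hI (fun x => f (x + A τ) - f x) c X
  have htr := localMass_translate_le f c X hτ hd hs1
  have hmono : ∑' p : Sites₀ t A, ‖f p‖ ^ 2 * 𝟙ᵇ[p, c, X] ≤ ∑' p : Sites₀ t A, ‖f p‖ ^ 2 * 𝟙ᵇ[p, c, X + d] := by
    refine hs0.tsum_le_tsum (fun p => ?_) hs1
    have h0 : 0 ≤ ‖f p‖ ^ 2 := sq_nonneg _
    by_cases hx : dist (p : EuclideanSpace ℝ (Fin 3)) c ≤ X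
    · rw [if_pos hx, if_pos (by linarith)]
    · rw [if_neg hx, mul_zero]; split_ifs <;> positivity
  have hpt : ∀ p : Sites₀ t A, ‖f ((p : EuclideanSpace ℝ (Fin 3)) + A τ) - f p‖ ^ 2 * 𝟙ᵇ[p, c, X] ≤
      2 * (‖f ((p : EuclideanSpace ℝ (Fin 3)) + A τ)‖ ^ 2 * 𝟙ᵇ[p, c, X]) + 2 * (‖f p‖ ^ 2 * 𝟙ᵇ[p, c, X]) := by
    intro p
    set a := ‖f ((p : EuclideanSpace ℝ (Fin 3)) + A τ)‖ with ha
    set b := ‖f p‖ with hb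
    have h : ‖f ((p : EuclideanSpace ℝ (Fin 3)) + A τ) - f p‖ ≤ a + b := norm_sub_le _ _
    have hsq : ‖f ((p : EuclideanSpace ℝ (Fin 3)) + A τ) - f p‖ ^ 2 ≤ 2 * a ^ 2 + 2 * b ^ 2 := by
      have h2 : ‖f ((p : EuclideanSpace ℝ (Fin 3)) + A τ) - f p‖ ^ 2 ≤ (a + b) ^ 2 := pow_le_pow_left₀ (norm_nonneg _) h 2
      have h3 : (a + b) ^ 2 ≤ 2 * a ^ 2 + 2 * b ^ 2 := by nlinarith [sq_nonneg (a - b)]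
      exact h2.trans h3
    by_cases hx : dist (p : EuclideanSpace ℝ (Fin 3)) c ≤ X
    · simp only [if_pos hx, mul_one]; linarith
    · simp only [if_neg hx, mul_zero, add_zero]; exact le_rfl
  calc ∑' p : Sites₀ t A, ‖f ((p : EuclideanSpace ℝ (Fin 3)) + A τ) - f p‖ ^ 2 * 𝟙ᵇ[p, c, X]
      ≤ ∑' p : Sites₀ t A, (2 * (‖f ((p : EuclideanSpace ℝ (Fin 3)) + A τ)‖ ^ 2 * 𝟙ᵇ[p, c, X]) + 2 * (‖f p‖ ^ 2 * 𝟙ᵇ[p, c, X])) :=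
        hsD.tsum_le_tsum hpt ((hsT.mul_left 2).add (hs0.mul_left 2))
    _ = 2 * (∑' p : Sites₀ t A, ‖f ((p : EuclideanSpace ℝ (Fin 3)) + A τ)‖ ^ 2 * 𝟙ᵇ[p, c, X]) +
        2 * ∑' p : Sites₀ t A, ‖f p‖ ^ 2 * 𝟙ᵇ[p, c, X] := by
        rw [(hsT.mul_left 2).tsum_add (hs0.mul_left 2), tsum_mul_left, tsum_mul_left]
    _ ≤ 2 * (∑' p : Sites₀ t A, ‖f p‖ ^ 2 * 𝟙ᵇ[p, c, X + d]) + 2 * ∑' p : Sites₀ t A, ‖f p‖ ^ 2 * 𝟙ᵇ[p, c, X + d] := by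
        gcongr
    _ = 4 * ∑' p : Sites₀ t A, ‖f p‖ ^ 2 * 𝟙ᵇ[p, c, X + d] := by ring

/-- A finitely supported displacement has summable squared norms over the sites. [folklore] -/
theorem summable_normSq_of_finite {f : (EuclideanSpace ℝ (Fin 3)) → (EuclideanSpace ℝ (Fin 3))}
    (hf : (Function.support f).Finite) : Summable fun p : Sites₀ t A => ‖f p‖ ^ 2 := by
  refine summable_of_ne_finset_zero (s := (finite_support_sites (t := t) (A := A) hf).toFinset) fun p hp => ?_
  have : f p = 0 := by
    by_contra h
    exact hp ((Set.Finite.mem_toFinset _).2 h)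
  rw [this, norm_zero, zero_pow two_ne_zero]

/-- **Total mass of a difference**: `Σ' ‖f(· + Aτ) − f‖² ≤ 4 Σ' ‖f‖²` for finitely supported `f`. [folklore] -/
theorem totMass_translate_sub_le {f : (EuclideanSpace ℝ (Fin 3)) → (EuclideanSpace ℝ (Fin 3))}
    (hf : (Function.support f).Finite) {τ : EuclideanSpace ℝ (Fin 3)} (hτ : τ ∈ Λ₀) :
    ∑' p : Sites₀ t A, ‖f ((p : EuclideanSpace ℝ (Fin 3)) + A τ) - f p‖ ^ 2 ≤ 4 * ∑' p : Sites₀ t A, ‖f p‖ ^ 2 := by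
  have hs0 : Summable fun p : Sites₀ t A => ‖f p‖ ^ 2 := summable_normSq_of_finite hf
  have hsT : Summable fun p : Sites₀ t A => ‖f ((p : EuclideanSpace ℝ (Fin 3)) + A τ)‖ ^ 2 := by
    have := summable_normSq_of_finite (t := t) (A := A) (finite_support_translate hf (A τ))
    simpa only using this
  have hsD : Summable fun p : Sites₀ t A => ‖f ((p : EuclideanSpace ℝ (Fin 3)) + A τ) - f p‖ ^ 2 := by
    have := summable_normSq_of_finite (t := t) (A := A) (finite_support_translate_sub hf (A τ))
    simpa only using this
  have htr : ∑' p : Sites₀ t A, ‖f ((p : EuclideanSpace ℝ (Fin 3)) + A τ)‖ ^ 2 = ∑' p : Sites₀ t A, ‖f p‖ ^ 2 :=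
    tsum_sites_translate (t := t) (A := A) (fun x => ‖f x‖ ^ 2) hτ
  have hpt : ∀ p : Sites₀ t A, ‖f ((p : EuclideanSpace ℝ (Fin 3)) + A τ) - f p‖ ^ 2 ≤
      2 * ‖f ((p : EuclideanSpace ℝ (Fin 3)) + A τ)‖ ^ 2 + 2 * ‖f p‖ ^ 2 := by
    intro p
    set a := ‖f ((p : EuclideanSpace ℝ (Fin 3)) + A τ)‖ with ha
    set b := ‖f p‖ with hb
    have h : ‖f ((p : EuclideanSpace ℝ (Fin 3)) + A τ) - f p‖ ≤ a + b := norm_sub_le _ _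
    have h2 : ‖f ((p : EuclideanSpace ℝ (Fin 3)) + A τ) - f p‖ ^ 2 ≤ (a + b) ^ 2 := pow_le_pow_left₀ (norm_nonneg _) h 2
    have h3 : (a + b) ^ 2 ≤ 2 * a ^ 2 + 2 * b ^ 2 := by nlinarith [sq_nonneg (a - b)]
    exact h2.trans h3
  calc ∑' p : Sites₀ t A, ‖f ((p : EuclideanSpace ℝ (Fin 3)) + A τ) - f p‖ ^ 2
      ≤ ∑' p : Sites₀ t A, (2 * ‖f ((p : EuclideanSpace ℝ (Fin 3)) + A τ)‖ ^ 2 + 2 * ‖f p‖ ^ 2) :=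
        hsD.tsum_le_tsum hpt ((hsT.mul_left 2).add (hs0.mul_left 2))
    _ = 2 * (∑' p : Sites₀ t A, ‖f ((p : EuclideanSpace ℝ (Fin 3)) + A τ)‖ ^ 2) + 2 * ∑' p : Sites₀ t A, ‖f p‖ ^ 2 := by
        rw [(hsT.mul_left 2).tsum_add (hs0.mul_left 2), tsum_mul_left, tsum_mul_left]
    _ = 4 * ∑' p : Sites₀ t A, ‖f p‖ ^ 2 := by rw [htr]; ring

/-- **The tail is at most the far lattice sum times the total mass**: `TT(f; c, R, ρ) ≤ F₈(ρ) · Σ' ‖f‖²`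
(`ρ ≥ 23/25`, `f` bounded and finitely supported). [folklore] -/
theorem tail_le_far_mul_totMass (hA : Adm₀ A) (hI : Inner₀ t A) {f : (EuclideanSpace ℝ (Fin 3)) → (EuclideanSpace ℝ (Fin 3))}
    (hf : (Function.support f).Finite) {B : ℝ} (hB : ∀ x, ‖f x‖ ≤ B) (c : EuclideanSpace ℝ (Fin 3)) (R : ℝ) {ρ : ℝ}
    (hρ : 23 / 25 ≤ ρ) :
    (∑' p : Sites₀ t A, ∑' q : Sites₀ t A, (if (p : (EuclideanSpace ℝ (Fin 3))) ≠ q then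
        𝔣[ρ, p, q] * 𝟙ᵇ[p, c, R] * ‖f q‖ ^ 2 else 0)) ≤
      1024 / ((23 / 25 : ℝ) ^ 3 * ρ ^ 5) * ∑' q : Sites₀ t A, ‖f q‖ ^ 2 := by
  have hW := summable_farTail hA hI hB c R hρ
  have hs0 : Summable fun q : Sites₀ t A => ‖f q‖ ^ 2 := summable_normSq_of_finite hf
  rw [← hW.tsum_comm, ← tsum_mul_left]
  have hcol : Summable fun q : Sites₀ t A => ∑' p : Sites₀ t A, (if (p : (EuclideanSpace ℝ (Fin 3))) ≠ q then
      𝔣[ρ, p, q] * 𝟙ᵇ[p, c, R] * ‖f q‖ ^ 2 else 0) := hW.prod_symm.prod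
  refine hcol.tsum_le_tsum (fun q => ?_) (hs0.mul_left _)
  obtain ⟨hfs, hfle⟩ := summable_far_inv_pow_eight_sites hA hI (q : (EuclideanSpace ℝ (Fin 3))) hρ
  have hrow : (∑' p : Sites₀ t A, (if (p : (EuclideanSpace ℝ (Fin 3))) ≠ q then 𝔣[ρ, p, q] * 𝟙ᵇ[p, c, R] * ‖f q‖ ^ 2 else 0)) ≤
      (∑' p : Sites₀ t A, 𝔣[ρ, p, q]) * ‖f q‖ ^ 2 := by
    rw [← tsum_mul_right]
    refine (hW.prod_symm.prod_factor q).tsum_le_tsum (fun p => ?_) (hfs.mul_right _)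
    have hf0 : (0 : ℝ) ≤ 𝔣[ρ, p, q] := by split_ifs <;> positivity
    have hi1 : (𝟙ᵇ[p, c, R] : ℝ) ≤ 1 := by split_ifs <;> norm_num
    have hi0 : (0 : ℝ) ≤ 𝟙ᵇ[p, c, R] := by split_ifs <;> norm_num
    by_cases hpq : (p : (EuclideanSpace ℝ (Fin 3))) = q
    · simp only [ne_eq, hpq, not_true_eq_false, if_false]
      positivity
    · simp only [if_pos hpq]
      have : 𝔣[ρ, p, q] * 𝟙ᵇ[p, c, R] ≤ 𝔣[ρ, p, q] := by nlinarith
      exact mul_le_mul_of_nonneg_right this (sq_nonneg _)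
  refine hrow.trans (mul_le_mul_of_nonneg_right hfle (sq_nonneg _))

/-- **Differences of a field with sublattice-constant operator rows are `L`-harmonic**: if `(L h)(p) = Gf p` for
`dist p c₀ ≤ ρ_h` with `Gf(p + Aτ) = Gf(p)` on the sites (`τ ∈ Λ₀`, `‖Aτ‖ ≤ 2`), then `(L (D_τ h))(p) = 0` for
`dist p c₀ ≤ ρ_h − 2`. [folklore] -/
theorem harm_translate_sub (hA : Adm₀ A) (hI : Inner₀ t A) {h : (EuclideanSpace ℝ (Fin 3)) → (EuclideanSpace ℝ (Fin 3))}
    {B : ℝ} (hB : ∀ x, ‖h x‖ ≤ B) {τ : EuclideanSpace ℝ (Fin 3)} (hτ : τ ∈ Λ₀) (hτ2 : ‖A τ‖ ≤ 2)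
    {Gf : (EuclideanSpace ℝ (Fin 3)) → (EuclideanSpace ℝ (Fin 3))} (hG : ∀ p : Sites₀ t A, Gf ((p : EuclideanSpace ℝ (Fin 3)) + A τ) = Gf p)
    {c₀ : EuclideanSpace ℝ (Fin 3)} {ρh : ℝ} (hharm : ∀ p : Sites₀ t A, dist (p : EuclideanSpace ℝ (Fin 3)) c₀ ≤ ρh → 𝕃 h @ p = Gf p)
    (p : Sites₀ t A) (hp : dist (p : EuclideanSpace ℝ (Fin 3)) c₀ ≤ ρh - 2) :
    𝕃 (fun x => h (x + A τ) - h x) @ p = 0 := by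
  rw [opRow_translate_sub hA hI hB hτ p]
  set p' : Sites₀ t A := ⟨(p : EuclideanSpace ℝ (Fin 3)) + A τ, add_mem_sites₀ p.2 hτ⟩ with hp'
  have h1 : 𝕃 h @ p' = Gf p' := by
    refine hharm p' ?_
    have := dist_triangle ((p : EuclideanSpace ℝ (Fin 3)) + A τ) (p : EuclideanSpace ℝ (Fin 3)) c₀
    have h2 : dist ((p : EuclideanSpace ℝ (Fin 3)) + A τ) (p : EuclideanSpace ℝ (Fin 3)) = ‖A τ‖ := by
      rw [dist_eq_norm, add_sub_cancel_left]
    show dist ((p : EuclideanSpace ℝ (Fin 3)) + A τ) c₀ ≤ ρh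
    linarith
  have h2 : 𝕃 h @ p = Gf p := hharm p (by linarith)
  have h1' : (∑' q : Sites₀ t A, (if (p : EuclideanSpace ℝ (Fin 3)) + A τ ≠ q then
      𝕂[(p : EuclideanSpace ℝ (Fin 3)) + A τ - q] (h ((p : EuclideanSpace ℝ (Fin 3)) + A τ) - h q) else 0)) = Gf p' := h1
  rw [h1', h2, hG p]
  exact sub_self _

/-- A finitely supported displacement is bounded. [folklore] -/
theorem exists_norm_le_of_finite {f : (EuclideanSpace ℝ (Fin 3)) → (EuclideanSpace ℝ (Fin 3))}
    (hf : (Function.support f).Finite) : ∃ B : ℝ, ∀ x, ‖f x‖ ≤ B := by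
  refine ⟨∑ x ∈ hf.toFinset, ‖f x‖, fun x => ?_⟩
  by_cases hx : f x = 0
  · rw [hx, norm_zero]
    exact Finset.sum_nonneg fun y _ => norm_nonneg _
  · exact Finset.single_le_sum (f := fun y => ‖f y‖) (fun y _ => norm_nonneg _) ((Set.Finite.mem_toFinset hf).2 hx)

/-! ## The tail split into a local mass and a weighted far mass -/

/-- Packing count in cubic form: a finite set of sites in the closed ball `dist · c ≤ r`, `r ≥ 1`, has at most
`32 r³` elements. [folklore] -/
theorem card_ball_sites_le (hA : Adm₀ A) (hI : Inner₀ t A) (c : EuclideanSpace ℝ (Fin 3)) {r : ℝ} (hr : 1 ≤ r)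
    (F : Finset (EuclideanSpace ℝ (Fin 3))) (hF : ∀ s ∈ F, s ∈ Sites₀ t A ∧ dist s c ≤ r) :
    (F.card : ℝ) ≤ 32 * r ^ 3 := by
  have h := card_le_of_separated_of_dist_le F c (by norm_num : (0 : ℝ) < 23 / 25) (by linarith)
    (fun s hs => (hF s hs).2) (fun a ha b hb hab => dist_sites_ge hA hI (hF a ha).1 (hF b hb).1 hab)
  rw [finrank_euclideanSpace_fin] at h
  refine h.trans ?_
  have h1 : 2 * r / (23 / 25) + 1 ≤ (73 / 23) * r := by
    rw [div_add_one (by norm_num), div_le_iff₀ (by norm_num)]; nlinarith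
  calc (2 * r / (23 / 25) + 1) ^ (3 : ℕ) ≤ ((73 / 23) * r) ^ (3 : ℕ) := pow_le_pow_left₀ (by positivity) h1 3
    _ = (73 / 23) ^ 3 * r ^ 3 := by ring
    _ ≤ 32 * r ^ 3 := by gcongr; norm_num

/-- A finitely supported displacement times a bounded-free weight: `Σ' ‖f p‖² · w p` is summable. [folklore] -/
theorem summable_normSq_mul_of_finite {f : (EuclideanSpace ℝ (Fin 3)) → (EuclideanSpace ℝ (Fin 3))}
    (hf : (Function.support f).Finite) (w : (EuclideanSpace ℝ (Fin 3)) → ℝ) :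
    Summable fun p : Sites₀ t A => ‖f p‖ ^ 2 * w p := by
  refine summable_of_ne_finset_zero (s := (finite_support_sites (t := t) (A := A) hf).toFinset) fun p hp => ?_
  have : f p = 0 := by
    by_contra h
    exact hp ((Set.Finite.mem_toFinset _).2 h)
  rw [this, norm_zero, zero_pow two_ne_zero, zero_mul]

/-- **The tail splits into a local mass and a weighted far mass**: for `1 ≤ R'`, `23/25 ≤ ρ'`, `0 < Y ≤ R'`,
`TT(f; c, R', ρ') ≤ (C₃/ρ'⁵) M(f; c, 2R') + 8192 R'³ · J_Y(f; c)` with the weighted far mass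
`J_Y(f; c) = Σ'_q ‖f q‖² (max(dist q c, Y))⁻⁸`: for `dist q c ≤ 2R'` the row sum over `p` is the far lattice
sum `F₈(ρ')`, and for `dist q c > 2R'` every `p ∈ B_{R'}(c)` has `dist p q ≥ dist q c / 2` and there are at
most `32R'³` of them. [folklore] -/
theorem tail_le_local_add_far (hA : Adm₀ A) (hI : Inner₀ t A) {f : (EuclideanSpace ℝ (Fin 3)) → (EuclideanSpace ℝ (Fin 3))}
    (hf : (Function.support f).Finite) (c : EuclideanSpace ℝ (Fin 3)) {R' ρ' Y : ℝ} (hR' : 1 ≤ R')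
    (hρ' : 23 / 25 ≤ ρ') (hY : 0 < Y) (hYR : Y ≤ R') :
    (∑' p : Sites₀ t A, ∑' q : Sites₀ t A, (if (p : (EuclideanSpace ℝ (Fin 3))) ≠ q then
        𝔣[ρ', p, q] * 𝟙ᵇ[p, c, R'] * ‖f q‖ ^ 2 else 0)) ≤
      1024 / ((23 / 25 : ℝ) ^ 3 * ρ' ^ 5) * (∑' q : Sites₀ t A, ‖f q‖ ^ 2 * 𝟙ᵇ[q, c, 2 * R']) +
      8192 * R' ^ 3 * (∑' q : Sites₀ t A, ‖f q‖ ^ 2 * (max (dist (q : EuclideanSpace ℝ (Fin 3)) c) Y)⁻¹ ^ 8) := by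
  obtain ⟨B, hB⟩ := exists_norm_le_of_finite hf
  have hW := summable_farTail hA hI hB c R' hρ'
  have hs1 : Summable fun q : Sites₀ t A => ‖f q‖ ^ 2 * 𝟙ᵇ[q, c, 2 * R'] := by
    have := summable_normSq_mul_of_finite (t := t) (A := A) hf (fun x => if dist x c ≤ 2 * R' then (1 : ℝ) else 0)
    simpa only using this
  have hs2 : Summable fun q : Sites₀ t A => ‖f q‖ ^ 2 * (max (dist (q : EuclideanSpace ℝ (Fin 3)) c) Y)⁻¹ ^ 8 := by
    have := summable_normSq_mul_of_finite (t := t) (A := A) hf (fun x => (max (dist x c) Y)⁻¹ ^ 8)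
    simpa only using this
  rw [← hW.tsum_comm, ← tsum_mul_left, ← tsum_mul_left, ← (hs1.mul_left _).tsum_add (hs2.mul_left _)]
  have hcol : Summable fun q : Sites₀ t A => ∑' p : Sites₀ t A, (if (p : (EuclideanSpace ℝ (Fin 3))) ≠ q then
      𝔣[ρ', p, q] * 𝟙ᵇ[p, c, R'] * ‖f q‖ ^ 2 else 0) := hW.prod_symm.prod
  refine hcol.tsum_le_tsum (fun q => ?_) ((hs1.mul_left _).add (hs2.mul_left _))
  have hrowS : Summable fun p : Sites₀ t A => (if (p : (EuclideanSpace ℝ (Fin 3))) ≠ q then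
      𝔣[ρ', p, q] * 𝟙ᵇ[p, c, R'] * ‖f q‖ ^ 2 else 0) := hW.prod_symm.prod_factor q
  obtain ⟨hfs, hfle⟩ := summable_far_inv_pow_eight_sites hA hI (q : (EuclideanSpace ℝ (Fin 3))) hρ'
  -- pointwise bounds on the summand
  have hf0 : ∀ p : Sites₀ t A, (0 : ℝ) ≤ 𝔣[ρ', p, q] := fun p => by split_ifs <;> positivity
  have hi01 : ∀ p : Sites₀ t A, (0 : ℝ) ≤ 𝟙ᵇ[p, c, R'] ∧ (𝟙ᵇ[p, c, R'] : ℝ) ≤ 1 := fun p => by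
    constructor <;> split_ifs <;> norm_num
  by_cases hq : dist (q : EuclideanSpace ℝ (Fin 3)) c ≤ 2 * R'
  · -- near column: the far lattice sum
    have h1 : (∑' p : Sites₀ t A, (if (p : (EuclideanSpace ℝ (Fin 3))) ≠ q then 𝔣[ρ', p, q] * 𝟙ᵇ[p, c, R'] * ‖f q‖ ^ 2 else 0)) ≤
        (∑' p : Sites₀ t A, 𝔣[ρ', p, q]) * ‖f q‖ ^ 2 := by
      rw [← tsum_mul_right]
      refine hrowS.tsum_le_tsum (fun p => ?_) (hfs.mul_right _)
      by_cases hpq : (p : (EuclideanSpace ℝ (Fin 3))) = q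
      · simp only [ne_eq, hpq, not_true_eq_false, if_false]
        exact mul_nonneg (hf0 q) (sq_nonneg _)
      · rw [if_pos hpq]
        have : 𝔣[ρ', p, q] * 𝟙ᵇ[p, c, R'] ≤ 𝔣[ρ', p, q] := by nlinarith [hf0 p, (hi01 p).1, (hi01 p).2]
        exact mul_le_mul_of_nonneg_right this (sq_nonneg _)
    have h2 : (∑' p : Sites₀ t A, 𝔣[ρ', p, q]) * ‖f q‖ ^ 2 ≤ 1024 / ((23 / 25 : ℝ) ^ 3 * ρ' ^ 5) * (‖f q‖ ^ 2 * 𝟙ᵇ[q, c, 2 * R']) := by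
      rw [if_pos hq, mul_one]
      exact mul_le_mul_of_nonneg_right hfle (sq_nonneg _)
    have h3 : (0 : ℝ) ≤ 8192 * R' ^ 3 * (‖f q‖ ^ 2 * (max (dist (q : EuclideanSpace ℝ (Fin 3)) c) Y)⁻¹ ^ 8) := by positivity
    linarith
  · -- far column: at most `32 R'³` sites `p`, each with `dist p q ≥ dist q c / 2`
    have hq' : 2 * R' < dist (q : EuclideanSpace ℝ (Fin 3)) c := lt_of_not_ge hq
    have hqY : Y ≤ dist (q : EuclideanSpace ℝ (Fin 3)) c := by linarith
    have hmax : max (dist (q : EuclideanSpace ℝ (Fin 3)) c) Y = dist (q : EuclideanSpace ℝ (Fin 3)) c := max_eq_left hqY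
    set F := (finite_sites_dist_le hA hI c R').toFinset with hFdef
    have hFmem : ∀ x ∈ F, x ∈ Sites₀ t A ∧ dist x c ≤ R' := fun x hx =>
      (Set.Finite.mem_toFinset (finite_sites_dist_le hA hI c R')).1 hx
    have hcard : (F.card : ℝ) ≤ 32 * R' ^ 3 := card_ball_sites_le hA hI c hR' F hFmem
    -- the row family vanishes off `F` and is bounded by `(dist q c / 2)⁻⁸ ‖f q‖²` on it
    have hbd : ∀ p : Sites₀ t A, (if (p : (EuclideanSpace ℝ (Fin 3))) ≠ q then 𝔣[ρ', p, q] * 𝟙ᵇ[p, c, R'] * ‖f q‖ ^ 2 else 0) ≤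
        𝟙ᵇ[p, c, R'] * ((dist (q : EuclideanSpace ℝ (Fin 3)) c / 2)⁻¹ ^ 8 * ‖f q‖ ^ 2) := by
      intro p
      by_cases hpq : (p : (EuclideanSpace ℝ (Fin 3))) = q
      · simp only [ne_eq, hpq, not_true_eq_false, if_false]
        have := (hi01 p).1
        positivity
      rw [if_pos hpq]
      by_cases hpc : dist (p : EuclideanSpace ℝ (Fin 3)) c ≤ R'
      · rw [if_pos hpc, mul_one, one_mul]
        refine mul_le_mul_of_nonneg_right ?_ (sq_nonneg _)
        have hdq : dist (q : EuclideanSpace ℝ (Fin 3)) c / 2 ≤ dist (p : EuclideanSpace ℝ (Fin 3)) q := by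
          have := dist_triangle (q : EuclideanSpace ℝ (Fin 3)) (p : EuclideanSpace ℝ (Fin 3)) c
          rw [dist_comm (q : EuclideanSpace ℝ (Fin 3)) (p : EuclideanSpace ℝ (Fin 3))] at this
          linarith
        have hpos : 0 < dist (q : EuclideanSpace ℝ (Fin 3)) c / 2 := by linarith
        split_ifs with hfar
        · exact pow_le_pow_left₀ (by positivity) ((inv_le_inv₀ (by linarith) hpos).2 hdq) 8
        · positivity
      · rw [if_neg hpc, mul_zero, zero_mul, zero_mul]
    have hsuppF : ∀ p : Sites₀ t A, p ∉ F.attach.image (fun x => (⟨x.1, (hFmem x.1 x.2).1⟩ : Sites₀ t A)) →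
        𝟙ᵇ[p, c, R'] * ((dist (q : EuclideanSpace ℝ (Fin 3)) c / 2)⁻¹ ^ 8 * ‖f q‖ ^ 2) = 0 := by
      intro p hp
      have hpc : ¬ dist (p : EuclideanSpace ℝ (Fin 3)) c ≤ R' := by
        intro hpc
        refine hp ?_
        rw [Finset.mem_image]
        refine ⟨⟨(p : EuclideanSpace ℝ (Fin 3)), (Set.Finite.mem_toFinset (finite_sites_dist_le hA hI c R')).2 ⟨p.2, hpc⟩⟩,
          Finset.mem_attach _ _, ?_⟩
        exact Subtype.ext rfl
      rw [if_neg hpc, zero_mul]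
    set G : Finset (Sites₀ t A) := F.attach.image (fun x => (⟨x.1, (hFmem x.1 x.2).1⟩ : Sites₀ t A)) with hG
    have hGcard : (G.card : ℝ) ≤ 32 * R' ^ 3 := by
      have h1 : G.card ≤ F.attach.card := Finset.card_image_le
      rw [Finset.card_attach] at h1
      exact le_trans (by exact_mod_cast h1) hcard
    have hsumG : (∑' p : Sites₀ t A, 𝟙ᵇ[p, c, R'] * ((dist (q : EuclideanSpace ℝ (Fin 3)) c / 2)⁻¹ ^ 8 * ‖f q‖ ^ 2)) =
        ∑ p ∈ G, 𝟙ᵇ[p, c, R'] * ((dist (q : EuclideanSpace ℝ (Fin 3)) c / 2)⁻¹ ^ 8 * ‖f q‖ ^ 2) :=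
      tsum_eq_sum fun p hp => hsuppF p hp
    have hK0 : (0 : ℝ) ≤ (dist (q : EuclideanSpace ℝ (Fin 3)) c / 2)⁻¹ ^ 8 * ‖f q‖ ^ 2 := by positivity
    calc (∑' p : Sites₀ t A, (if (p : (EuclideanSpace ℝ (Fin 3))) ≠ q then 𝔣[ρ', p, q] * 𝟙ᵇ[p, c, R'] * ‖f q‖ ^ 2 else 0))
        ≤ ∑' p : Sites₀ t A, 𝟙ᵇ[p, c, R'] * ((dist (q : EuclideanSpace ℝ (Fin 3)) c / 2)⁻¹ ^ 8 * ‖f q‖ ^ 2) :=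
          hrowS.tsum_le_tsum hbd (summable_of_ne_finset_zero (s := G) fun p hp => hsuppF p hp)
      _ = ∑ p ∈ G, 𝟙ᵇ[p, c, R'] * ((dist (q : EuclideanSpace ℝ (Fin 3)) c / 2)⁻¹ ^ 8 * ‖f q‖ ^ 2) := hsumG
      _ ≤ ∑ p ∈ G, ((dist (q : EuclideanSpace ℝ (Fin 3)) c / 2)⁻¹ ^ 8 * ‖f q‖ ^ 2) := by
          refine Finset.sum_le_sum fun p _ => ?_
          have := (hi01 p).2
          have := (hi01 p).1
          nlinarith
      _ = G.card * ((dist (q : EuclideanSpace ℝ (Fin 3)) c / 2)⁻¹ ^ 8 * ‖f q‖ ^ 2) := by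
          rw [Finset.sum_const, nsmul_eq_mul]
      _ ≤ 32 * R' ^ 3 * ((dist (q : EuclideanSpace ℝ (Fin 3)) c / 2)⁻¹ ^ 8 * ‖f q‖ ^ 2) :=
          mul_le_mul_of_nonneg_right hGcard hK0
      _ = 8192 * R' ^ 3 * (‖f q‖ ^ 2 * (max (dist (q : EuclideanSpace ℝ (Fin 3)) c) Y)⁻¹ ^ 8) := by
          rw [hmax, div_eq_mul_inv, mul_inv, inv_inv, mul_pow]
          norm_num
          ring
      _ ≤ _ := by
          have : (0 : ℝ) ≤ 1024 / ((23 / 25 : ℝ) ^ 3 * ρ' ^ 5) * (‖f q‖ ^ 2 * 𝟙ᵇ[q, c, 2 * R']) := by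
            have hρ0 : 0 < ρ' := by linarith
            rw [if_neg hq, mul_zero, mul_zero]
          linarith

end

end Summit.AtomisticToContinuum.Crystallization.Theorems.ExcessDecayLiouville

end
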